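import Summits.QuantumFields.YangMills.Theorems.FluctuationComparisonRegPrIntLOrganTangentNearFamilyStability
import Summits.QuantumFields.YangMills.Theorems.FluctuationComparisonRegPrIntLOrganTangentFibreWeightSquareIntegrability
import Summits.QuantumFields.YangMills.Theorems.FluctuationComparisonRegPrIntLOrganTangentLipschitzProductTools
import HarnessLib

/-!
# Crux `FluctuationComparisonRegPrIntL` (stmt-QuantumFields-20520, rung R3), PATH-B organ, H-currency cone — (L39b) «(W-Lip) FROM THE CHART-PRIMITIVE PATH LETTERS»: the uniform
# weight-Lipschitz letter of ✓(L38) `…OrganTangentILawRegOfWeightLip` (hence the REG′ halves of all four A2′ (I-law) blocks of row-sq v0.3) from three displayed regularity letters on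
# the chart's primitives `Φ`, `log ρ_Ts∘Φ ∕ log ρ′_Ts∘Φ`, `J` along near coarse one-bond paths — with the t-UNIFORMITY of the interpolated density factor `ρ^t·ρ′^{1−t}` PROVED

Cell `ym3-torus` (YM ladder rung R3 = continuum `SU(2)` Yang–Mills on the three-torus — a RUNG: NOT d = 4, NOT infinite volume, NOT a mass gap, NOT Clay).
Width seat `ym-ust-20520-w5` (gen 25), `--kind proof --supports stmt-QuantumFields-20520 --as helper`, count-neutral, DEFINITION-FREE, default heartbeats,
no registry ∕ binder ∕ `Lines/` edit.  Over ✓p820913 `…NearFamilyStability` (import hub for the organ frame vocabulary), ✓p815882 `…FibreWeightSquareIntegrability`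
(`continuous_dist1_SU` ∕ `continuous_plaqHol_SU` route to compactness bounds), ✓(L39a) `…OrganTangentLipschitzProductTools`, `T3DescentFibreTower.descendTo_self`.

WHY (DISCHARGE-SPEC v1.5 §D3 «the score needs `∂_s` of `χ∘Φ`, `ρ^t∘Φ`, `ρ′^{1−t}∘Φ`, `J` along the coarse move: D0's differentiability of the chart + (β) for `log ρ`»; §D4
«t-UNIFORMITY over `[0,1]`: the interpolated action `t·log ρ + (1−t)·log ρ′` stays in the class — to be stated as a lemma of the discharge, not assumed»).  ✓(L38) reduced the
(I-law) REGULARITY debt REG′ to ONE letter (W-Lip) on the interpolated weight `wNum_t = (χ∘Φ)·(ρ_Ts^t·ρ′_Ts^{1−t}∘Φ)·J`.  This file factors (W-Lip) through the weight's three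
primitives, proving the calculus once and leaving to the D0 «MINIMISER CHART» typer exactly three print-shaped moduli, read along near relational coarse one-bond paths (and
square edges), pointwise in the fibre coordinate `z`:
* (Φ-disp-Lip) ONE modulus `D` for every fine plaquette variable `s ↦ dist1 (plaqHol (descendTo n Ts (Φ (X s, z))) p)` at every level `j < n ≤ Ts` — the Lipschitz form of the
  row's one-sided displacement letter `hdisp` ([Balaban1985Variational] Thm 1 (10) p.279 ∕ Prop 9 (190) p.309: the minimiser's response to the datum — SOURCE of the shape only);
* (logρ-Lip)(logρ′-Lip) moduli `Kρ, Kρ′` for `s ↦ log ρ_Ts (Φ (X s, z))`, `log ρ′_Ts (Φ (X s, z))` on the sub-window set `{s | PlaqSmall (24∕25·θ_Ts) (Φ (X s, z))}` (where the cut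
  can be non-zero) — (β)-type regularity of the effective densities composed with the chart ([Balaban1987RG1] Thm 1 ∕ (0.22)–(0.25), SOURCE only);
* (J-Lip) a modulus `KJ` for the Jacobian `s ↦ J (X s, z)`.

WHAT (§0 = the Mathlib-only tools of ✓(L39a) `…OrganTangentLipschitzProductTools`: support product rule, finite `[0,1]`-products, the ramp, `exp` on `(-∞, B]`).
§1 ★`lipschitzOnWith_mwCut_comp`: the multi-window cut along ANY fine curve is Lipschitz with the curve-free modulus `Kχ = Σ_{i<Ts−j} Σ_{p ∈ Plaq_{j+1+i}} D∕((24∕25 − 1∕2)·θ_{j+1+i})`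
from (Φ-disp-Lip).  §2 `exists_abs_log_le_of_plaq_le` (compactness bound `ML` of `|log ρ_Ts|` on the closed `24∕25·θ_Ts`-window from the frame's continuity + positivity),
★★`lipschitzOnWith_rpowFactor`: on the sub-window set, `ρ_Ts^t·ρ′_Ts^{1−t}` along the curve is Lipschitz with modulus `e^{ML+ML′}·(Kρ + Kρ′)` and valued in `(0, e^{ML+ML′}]`
UNIFORMLY IN `t ∈ [0,1]` — the t-uniformity lemma of SPEC §D4 at first order (`Real.rpow_def_of_pos`, convexity of the exponent in `t`).  §3 `mwCut_mem_Icc`,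
★★`lipschitzOnWith_wNum_of_chartLetters`: along a coarse curve `C` and at a fibre point `z`, `s ↦ wNum_t (C s) z` is Lipschitz on `I` with the EXPLICIT curve-, fibre- and
`t`-free modulus `bW = (Kχ·e^{ML+ML′} + e^{ML+ML′}·(Kρ+Kρ′))·CJ + e^{ML+ML′}·KJ` (cut × density factor by the support product rule — the density letters are needed only where the
cut lives — then × `J ≤ CJ`).  §4 ★★★`weightLip_of_chartLetters`: `∃ bW : ℝ, ∀ t ∈ [0,1]`, BOTH (W-Lip) clauses of ✓(L38) — paths `∀ B′ m′ U₂ X, … → ∀ᵐ z ∂τ, LipschitzOnWith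
(Real.nnabs bW) (fun s => wNum … t (X s) z) (Set.Ioo (-1) 2)` and squares `… → ∀ s′ ∈ Icc 0 1, ∀ᵐ z ∂τ, …` VERBATIM — from the three letters quantified over near relational paths and
square edges + the frame.  So a discharger of REG′ writes `obtain ⟨bW, hW⟩ := weightLip_of_chartLetters …` and feeds `(hW t ht0 ht1).1 ∕ .2` to ✓`ilawRegX∕V3∕Sq_of_weightLip`.

HONEST FRAMING: [folklore] calculus over HYPOTHESIS letters; (Φ-disp-Lip), (logρ-Lip), (logρ′-Lip), (J-Lip) are exactly as OPEN as (W-Lip) ∕ REG′ (they are the D0∕(P1) chart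
material in primitive form — nothing here constructs Bałaban's chart or proves a property of it); nothing of Bałaban's analysis is asserted or proved; KER′, (I-curv), (I-cov),
`hdisp` untouched and OPEN; `OrganDischargeInputsHJ(sq)` ∕ `SpreadFibreLawH(J)(sq)` UNDISCHARGED; the five registered stubs of `Lines/semiclassical_s2beta.lean`, crux 20520 and
`YM3TorusSU2` are NOT proved; registry untouched; rung R3 = SU(2) YM₃ on T³ at fixed lattice data — NOT d = 4, NOT infinite volume, NOT a mass gap, NOT Clay; the Yang–Mills
mass gap is NOT proved.  [folklore]
-/

set_option autoImplicit false

noncomputable section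

namespace Summit.QuantumFields.YangMills.Theorems.OrganTangentWeightLipOfChartLetters

open MeasureTheory Filter Topology Set Function
open scoped ENNReal NNReal BigOperators
open Literature.MathematicalPhysics.QuantumFieldTheory.Balaban1983to89 T3ContinuumYM3Torus T3NestedUnitLaws T3UnitLawDensityEML T4Continuum BalabanUVClass
  T3UnitScaleTilt T3LevelShift T3TiltDescent
open T4CubeChartExp (expPt)
open Literature.MathematicalPhysics.QuantumFieldTheory.Balaban1983to89.B12ContinuousTransportInvarianceOn (continuous_dist1_SU continuous_plaqHol_SU)
open Summit.QuantumFields.YangMills.Theorems.FluctuationComparisonRegPrIntLRunpairOrganFibreLaw (mwCut wNum)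
open Summit.QuantumFields.YangMills.Theorems.OrganTangentLipschitzProductTools

/-! ## §1 The cut along a fine curve: Lipschitz from per-level plaquette-displacement moduli -/

section Cut

variable (F : T3Family) (γ b₀ p₀ : ℝ) (j Ts : ℕ)

/-- ★ **THE MULTI-WINDOW CUT ALONG A FINE CURVE IS LIPSCHITZ** from ONE plaquette-displacement modulus `D` at every level `j < n ≤ Ts` (letter (Φ-disp-Lip) read on the curve):
modulus `Kχ = Σ_{i < Ts−j} Σ_{p ∈ Plaq_{j+1+i}} (1∕((24∕25 − 1∕2)·θ_{j+1+i}))·D` — INDEPENDENT of the curve and of the parameter set. [folklore] -/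
theorem lipschitzOnWith_mwCut_comp (hθ : ∀ n, 0 < θBal F.L γ b₀ p₀ n) (D : ℝ≥0)
    (c : ℝ → GaugeField (F.P Ts) 0 ↥(Matrix.specialUnitaryGroup (Fin 2) ℂ)) (I : Set ℝ)
    (hdisp : ∀ (n : ℕ) (hjn : j + 1 ≤ n) (hnT : n ≤ Ts) (p : Plaq (F.P n) 0),
      LipschitzOnWith D (fun s => dist1 (GaugeField.plaqHol (descendTo F ℰp n Ts hnT (c s)) p)) I) :
    LipschitzOnWith (∑ i ∈ Finset.range (Ts - j), ∑ _p : Plaq (F.P (j + 1 + i)) 0, Real.toNNReal (1 / ((24 / 25 - 1 / 2) * θBal F.L γ b₀ p₀ (j + 1 + i))) * D)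
      (fun s => mwCut F γ b₀ p₀ j Ts (c s)) I := by
  unfold mwCut
  refine lipschitzOnWith_finset_prod (Finset.range (Ts - j)) (fun i hi s _ => ?_) (fun i hi => ?_)
  · have h : j + 1 + i ≤ Ts := by have := Finset.mem_range.1 hi; omega
    simp only [dif_pos h]
    exact ⟨Finset.prod_nonneg fun p _ => (ramp_mem_Icc _ _ _).1, Finset.prod_le_one (fun p _ => (ramp_mem_Icc _ _ _).1) fun p _ => (ramp_mem_Icc _ _ _).2⟩
  · have h : j + 1 + i ≤ Ts := by have := Finset.mem_range.1 hi; omega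
    simp only [dif_pos h]
    refine lipschitzOnWith_finset_prod Finset.univ (fun p _ s _ => ramp_mem_Icc _ _ _) (fun p _ => ?_)
    have hw : 0 < (24 / 25 - 1 / 2) * θBal F.L γ b₀ p₀ (j + 1 + i) := by have := hθ (j + 1 + i); positivity
    exact (lipschitzWith_ramp (a := 24 / 25 * θBal F.L γ b₀ p₀ (j + 1 + i)) hw).comp_lipschitzOnWith (hdisp (j + 1 + i) (by omega) h p)

end Cut

/-! ## §2 The interpolated density factor along a fine curve, on the `24∕25·θ_Ts`-window -/

section Density

variable (F : T3Family) (γ b₀ p₀ : ℝ) (Ts : ℕ)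

/-- On the closed `24∕25·θ_Ts`-window a density continuous and positive on the open `θ_Ts`-window has `|log ρ| ≤ ML` (compactness). [folklore] -/
theorem exists_abs_log_le_of_plaq_le (ρT : GaugeField (F.P Ts) 0 ↥(Matrix.specialUnitaryGroup (Fin 2) ℂ) → ℝ)
    (hc : ContinuousOn ρT {U | PlaqSmall (θBal F.L γ b₀ p₀ Ts) U}) (hpos : ∀ U, PlaqSmall (θBal F.L γ b₀ p₀ Ts) U → 0 < ρT U)
    (hθ : 0 < θBal F.L γ b₀ p₀ Ts) :
    ∃ ML : ℝ, ∀ U : GaugeField (F.P Ts) 0 ↥(Matrix.specialUnitaryGroup (Fin 2) ℂ),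
      (∀ p, dist1 (GaugeField.plaqHol U p) ≤ 24 / 25 * θBal F.L γ b₀ p₀ Ts) → |Real.log (ρT U)| ≤ ML := by
  haveI : CompactSpace (GaugeField (F.P Ts) 0 ↥(Matrix.specialUnitaryGroup (Fin 2) ℂ)) :=
    inferInstanceAs (CompactSpace (PBond (F.P Ts) 0 → ↥(Matrix.specialUnitaryGroup (Fin 2) ℂ)))
  set C : Set (GaugeField (F.P Ts) 0 ↥(Matrix.specialUnitaryGroup (Fin 2) ℂ)) :=
    {U | ∀ p, dist1 (GaugeField.plaqHol U p) ≤ 24 / 25 * θBal F.L γ b₀ p₀ Ts} with hC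
  have hCclosed : IsClosed C := by
    have : C = ⋂ p, {U | dist1 (GaugeField.plaqHol U p) ≤ 24 / 25 * θBal F.L γ b₀ p₀ Ts} := by
      ext U; simp only [hC, Set.mem_setOf_eq, Set.mem_iInter]
    rw [this]
    exact isClosed_iInter fun p => isClosed_le ((continuous_dist1_SU (N := 2)).comp (continuous_plaqHol_SU (N := 2) p)) continuous_const
  have hCO : C ⊆ {U | PlaqSmall (θBal F.L γ b₀ p₀ Ts) U} := by
    intro U hU p
    exact lt_of_le_of_lt (hU p) (by nlinarith)
  have hhc : ContinuousOn (fun U => Real.log (ρT U)) C := (hc.log fun U hU => (hpos U hU).ne').mono hCO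
  obtain ⟨M, hM⟩ := hCclosed.isCompact.exists_bound_of_continuousOn hhc
  exact ⟨M, fun U hU => by rw [← Real.norm_eq_abs]; exact hM U hU⟩

/-- ★ **THE INTERPOLATED DENSITY FACTOR `ρ^t·ρ′^{1−t}` ALONG A FINE CURVE** on the parameter set `S` where the curve is in the `24∕25·θ_Ts`-window: from Lipschitz moduli `Kρ`,
`Kρ′` of `log ρ_Ts ∘ c`, `log ρ′_Ts ∘ c` on `S` and the frame (continuity + positivity on the `θ_Ts`-window), for `t ∈ [0,1]`: Lipschitz on `S` with modulus
`e^{ML+ML′}·(Kρ + Kρ′)` and values in `(0, e^{ML+ML′}]`, where `ML, ML′` bound `|log ρ_Ts|, |log ρ′_Ts|` on the closed window (`exists_abs_log_le_of_plaq_le`). [folklore] -/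
theorem lipschitzOnWith_rpowFactor (ρ ρ' : (i : ℕ) → GaugeField (F.P i) 0 ↥(Matrix.specialUnitaryGroup (Fin 2) ℂ) → ℝ)
    (hpos : ∀ U, PlaqSmall (θBal F.L γ b₀ p₀ Ts) U → 0 < ρ Ts U ∧ 0 < ρ' Ts U) (hθ : 0 < θBal F.L γ b₀ p₀ Ts)
    (ML ML' : ℝ) (hML : ∀ U, (∀ p, dist1 (GaugeField.plaqHol U p) ≤ 24 / 25 * θBal F.L γ b₀ p₀ Ts) → |Real.log (ρ Ts U)| ≤ ML)
    (hML' : ∀ U, (∀ p, dist1 (GaugeField.plaqHol U p) ≤ 24 / 25 * θBal F.L γ b₀ p₀ Ts) → |Real.log (ρ' Ts U)| ≤ ML')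
    (c : ℝ → GaugeField (F.P Ts) 0 ↥(Matrix.specialUnitaryGroup (Fin 2) ℂ)) (S : Set ℝ)
    (hS : ∀ s ∈ S, PlaqSmall (24 / 25 * θBal F.L γ b₀ p₀ Ts) (c s)) (Kρ Kρ' : ℝ≥0)
    (hLρ : LipschitzOnWith Kρ (fun s => Real.log (ρ Ts (c s))) S) (hLρ' : LipschitzOnWith Kρ' (fun s => Real.log (ρ' Ts (c s))) S)
    (t : ℝ) (ht0 : 0 ≤ t) (ht1 : t ≤ 1) :
    LipschitzOnWith (Real.toNNReal (Real.exp (ML + ML')) * (Kρ + Kρ')) (fun s => Real.rpow (ρ Ts (c s)) t * Real.rpow (ρ' Ts (c s)) (1 - t)) S ∧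
    (∀ s ∈ S, 0 < Real.rpow (ρ Ts (c s)) t * Real.rpow (ρ' Ts (c s)) (1 - t) ∧ Real.rpow (ρ Ts (c s)) t * Real.rpow (ρ' Ts (c s)) (1 - t) ≤ Real.exp (ML + ML')) := by
  have hwin : ∀ s ∈ S, PlaqSmall (θBal F.L γ b₀ p₀ Ts) (c s) := fun s hs p => (hS s hs p).trans (by nlinarith)
  have hle : ∀ s ∈ S, ∀ p, dist1 (GaugeField.plaqHol (c s) p) ≤ 24 / 25 * θBal F.L γ b₀ p₀ Ts := fun s hs p => (hS s hs p).le
  -- on `S` the factor is `exp (t·log ρ + (1−t)·log ρ′)`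
  set L : ℝ → ℝ := fun s => t * Real.log (ρ Ts (c s)) + (1 - t) * Real.log (ρ' Ts (c s)) with hLdef
  have heq : ∀ s ∈ S, Real.rpow (ρ Ts (c s)) t * Real.rpow (ρ' Ts (c s)) (1 - t) = Real.exp (L s) := by
    intro s hs
    obtain ⟨h1, h2⟩ := hpos _ (hwin s hs)
    rw [Real.rpow_eq_pow, Real.rpow_eq_pow, Real.rpow_def_of_pos h1, Real.rpow_def_of_pos h2, ← Real.exp_add, hLdef]
    ring_nf
  have hB : ∀ s ∈ S, L s ≤ ML + ML' := by
    intro s hs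
    have a1 := (abs_le.1 (hML _ (hle s hs))).2
    have a2 := (abs_le.1 (hML' _ (hle s hs))).2
    have b1 := (abs_le.1 (hML _ (hle s hs))).1
    have b2 := (abs_le.1 (hML' _ (hle s hs))).1
    simp only [hLdef]
    nlinarith
  have hLlip : LipschitzOnWith (Kρ + Kρ') L S := by
    rw [lipschitzOnWith_iff_dist_le_mul] at hLρ hLρ' ⊢
    intro x hx y hy
    have h1 := hLρ x hx y hy
    have h2 := hLρ' x hx y hy
    rw [Real.dist_eq] at h1 h2 ⊢
    have hd : 0 ≤ dist x y := dist_nonneg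
    have e : L x - L y = t * (Real.log (ρ Ts (c x)) - Real.log (ρ Ts (c y))) + (1 - t) * (Real.log (ρ' Ts (c x)) - Real.log (ρ' Ts (c y))) := by
      simp only [hLdef]; ring
    rw [e, NNReal.coe_add, add_mul]
    refine (abs_add_le _ _).trans (add_le_add ?_ ?_)
    · rw [abs_mul, abs_of_nonneg ht0]
      calc t * |Real.log (ρ Ts (c x)) - Real.log (ρ Ts (c y))| ≤ 1 * (Kρ * dist x y) := mul_le_mul ht1 h1 (abs_nonneg _) zero_le_one
        _ = Kρ * dist x y := one_mul _
    · rw [abs_mul, abs_of_nonneg (sub_nonneg.2 ht1)]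
      calc (1 - t) * |Real.log (ρ' Ts (c x)) - Real.log (ρ' Ts (c y))| ≤ 1 * (Kρ' * dist x y) := mul_le_mul (by linarith) h2 (abs_nonneg _) zero_le_one
        _ = Kρ' * dist x y := one_mul _
  have hexp := lipschitzOnWith_exp_of_le hLlip hB
  refine ⟨?_, fun s hs => ?_⟩
  · rw [lipschitzOnWith_iff_dist_le_mul] at hexp ⊢
    intro x hx y hy
    rw [heq x hx, heq y hy]
    exact hexp x hx y hy
  · rw [heq s hs]
    exact ⟨Real.exp_pos _, Real.exp_le_exp.2 (hB s hs)⟩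

end Density

/-! ## §3 The interpolated weight along a coarse curve: (W-Lip)'s modulus from the chart-primitive path letters -/

section Weight

variable (F : T3Family) (γ b₀ p₀ : ℝ) (j Ts : ℕ)

/-- The multi-window cut takes values in `[0,1]`. [folklore] -/
theorem mwCut_mem_Icc (U : GaugeField (F.P Ts) 0 ↥(Matrix.specialUnitaryGroup (Fin 2) ℂ)) : mwCut F γ b₀ p₀ j Ts U ∈ Icc (0:ℝ) 1 := by
  unfold mwCut
  have h01 : ∀ i ∈ Finset.range (Ts - j), (if h : j + 1 + i ≤ Ts then (∏ p : Plaq (F.P (j + 1 + i)) 0, max 0 (min 1 ((24 / 25 * θBal F.L γ b₀ p₀ (j + 1 + i)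
      - dist1 (GaugeField.plaqHol (descendTo F ℰp (j + 1 + i) Ts h U) p)) / ((24 / 25 - 1 / 2) * θBal F.L γ b₀ p₀ (j + 1 + i))))) else 1) ∈ Icc (0:ℝ) 1 := by
    intro i hi
    have h : j + 1 + i ≤ Ts := by have := Finset.mem_range.1 hi; omega
    simp only [dif_pos h]
    exact ⟨Finset.prod_nonneg fun p _ => (ramp_mem_Icc _ _ _).1, Finset.prod_le_one (fun p _ => (ramp_mem_Icc _ _ _).1) fun p _ => (ramp_mem_Icc _ _ _).2⟩
  exact ⟨Finset.prod_nonneg fun i hi => (h01 i hi).1, Finset.prod_le_one (fun i hi => (h01 i hi).1) fun i hi => (h01 i hi).2⟩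

/-- ★★ **THE INTERPOLATED WEIGHT ALONG A COARSE CURVE IS LIPSCHITZ, WITH A CURVE- AND FIBRE-FREE MODULUS, FROM THE CHART-PRIMITIVE PATH LETTERS** — for a coarse curve `C` and a
fibre point `z`, write `c s := Φ (C s, z)`; from (Φ-disp-Lip) ONE plaquette-displacement modulus `D` of `c` at every level `j < n ≤ Ts` on `I`, (logρ-Lip)(logρ′-Lip) moduli
`Kρ, Kρ′` of `log ρ_Ts ∘ c`, `log ρ′_Ts ∘ c` on the sub-window set `{s ∈ I | PlaqSmall (24∕25·θ_Ts) (c s)}`, (J-Lip) a modulus `KJ` of `s ↦ J (C s, z)` on `I` + the frame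
(`hχsupp`, positivity∕continuity of `ρ_Ts, ρ′_Ts` on the `θ_Ts`-window via the bounds `ML, ML′`, `J ≤ CJ`), for `t ∈ [0,1]`:
`LipschitzOnWith bW (s ↦ wNum_t (C s) z) I` with `bW = (Kχ·e^{ML+ML′} + e^{ML+ML′}·(Kρ+Kρ′))·CJ + e^{ML+ML′}·KJ`, `Kχ` = §1's modulus. [folklore] -/
theorem lipschitzOnWith_wNum_of_chartLetters (hjTs : j + 1 ≤ Ts)
    (ρ ρ' : (i : ℕ) → GaugeField (F.P i) 0 ↥(Matrix.specialUnitaryGroup (Fin 2) ℂ) → ℝ)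
    (hpos : ∀ U, PlaqSmall (θBal F.L γ b₀ p₀ Ts) U → 0 < ρ Ts U ∧ 0 < ρ' Ts U) (hθ : ∀ n, 0 < θBal F.L γ b₀ p₀ n)
    (ML ML' : ℝ) (hML : ∀ U, (∀ p, dist1 (GaugeField.plaqHol U p) ≤ 24 / 25 * θBal F.L γ b₀ p₀ Ts) → |Real.log (ρ Ts U)| ≤ ML)
    (hML' : ∀ U, (∀ p, dist1 (GaugeField.plaqHol U p) ≤ 24 / 25 * θBal F.L γ b₀ p₀ Ts) → |Real.log (ρ' Ts U)| ≤ ML')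
    (hχsupp : ∀ U, mwCut F γ b₀ p₀ j Ts U ≠ 0 → ∀ (n : ℕ) (hjn : j + 1 ≤ n) (hnK : n ≤ Ts), PlaqSmall (24 / 25 * θBal F.L γ b₀ p₀ n) (descendTo F ℰp n Ts hnK U))
    {Z : Type} (Φ : GaugeField (F.P j) 0 ↥(Matrix.specialUnitaryGroup (Fin 2) ℂ) × Z → GaugeField (F.P Ts) 0 ↥(Matrix.specialUnitaryGroup (Fin 2) ℂ))
    (J : GaugeField (F.P j) 0 ↥(Matrix.specialUnitaryGroup (Fin 2) ℂ) × Z → ℝ≥0) (CJ : ℝ) (hJle : ∀ V z, (J (V, z) : ℝ) ≤ CJ)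
    (t : ℝ) (ht0 : 0 ≤ t) (ht1 : t ≤ 1) (D Kρ Kρ' KJ : ℝ≥0)
    (C : ℝ → GaugeField (F.P j) 0 ↥(Matrix.specialUnitaryGroup (Fin 2) ℂ)) (z : Z) (I : Set ℝ)
    (hdisp : ∀ (n : ℕ) (hjn : j + 1 ≤ n) (hnT : n ≤ Ts) (p : Plaq (F.P n) 0),
      LipschitzOnWith D (fun s => dist1 (GaugeField.plaqHol (descendTo F ℰp n Ts hnT (Φ (C s, z))) p)) I)
    (hLρ : LipschitzOnWith Kρ (fun s => Real.log (ρ Ts (Φ (C s, z)))) {s | s ∈ I ∧ PlaqSmall (24 / 25 * θBal F.L γ b₀ p₀ Ts) (Φ (C s, z))})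
    (hLρ' : LipschitzOnWith Kρ' (fun s => Real.log (ρ' Ts (Φ (C s, z)))) {s | s ∈ I ∧ PlaqSmall (24 / 25 * θBal F.L γ b₀ p₀ Ts) (Φ (C s, z))})
    (hLJ : LipschitzOnWith KJ (fun s => (J (C s, z) : ℝ)) I) :
    LipschitzOnWith (((∑ i ∈ Finset.range (Ts - j), ∑ _p : Plaq (F.P (j + 1 + i)) 0, Real.toNNReal (1 / ((24 / 25 - 1 / 2) * θBal F.L γ b₀ p₀ (j + 1 + i))) * D)
        * Real.toNNReal (Real.exp (ML + ML')) + Real.toNNReal 1 * (Real.toNNReal (Real.exp (ML + ML')) * (Kρ + Kρ'))) * Real.toNNReal CJ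
        + Real.toNNReal (Real.exp (ML + ML')) * KJ)
      (fun s => wNum F γ b₀ p₀ j Ts ρ ρ' Φ J t (C s) z) I := by
  -- the support of the cut along the curve sits in the sub-window set
  set S : Set ℝ := {s | s ∈ I ∧ PlaqSmall (24 / 25 * θBal F.L γ b₀ p₀ Ts) (Φ (C s, z))} with hSdef
  have hsupp : ∀ s ∈ I, mwCut F γ b₀ p₀ j Ts (Φ (C s, z)) ≠ 0 → s ∈ S := by
    intro s hs hχ
    refine ⟨hs, fun q => ?_⟩
    have h := hχsupp _ hχ Ts hjTs le_rfl q
    rw [T3DescentFibreTower.descendTo_self] at h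
    exact h
  -- the three factors
  have hA := lipschitzOnWith_mwCut_comp F γ b₀ p₀ j Ts hθ D (fun s => Φ (C s, z)) I hdisp
  obtain ⟨hR, hRb⟩ := lipschitzOnWith_rpowFactor F γ b₀ p₀ Ts ρ ρ' hpos (hθ Ts) ML ML' hML hML' (fun s => Φ (C s, z)) S (fun s hs => hs.2)
    Kρ Kρ' hLρ hLρ' t ht0 ht1
  have hB0 : 0 ≤ Real.exp (ML + ML') := (Real.exp_pos _).le
  -- cut × density factor, product rule on the support of the cut
  have hAR := lipschitzOnWith_mul_of_support (Mf := 1) (Mg := Real.exp (ML + ML')) hA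
    (fun s _ => by rw [abs_of_nonneg (mwCut_mem_Icc F γ b₀ p₀ j Ts _).1]; exact (mwCut_mem_Icc F γ b₀ p₀ j Ts _).2)
    (hR.mono fun s hs => hsupp s hs.1 hs.2)
    (fun s hs hχ => by
      have h := hRb s (hsupp s hs hχ)
      rw [abs_of_pos h.1]; exact h.2) zero_le_one hB0
  -- bound of the product on `I`
  have hARb : ∀ s ∈ I, |mwCut F γ b₀ p₀ j Ts (Φ (C s, z)) * (Real.rpow (ρ Ts (Φ (C s, z))) t * Real.rpow (ρ' Ts (Φ (C s, z))) (1 - t))| ≤ Real.exp (ML + ML') := by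
    intro s hs
    by_cases hχ : mwCut F γ b₀ p₀ j Ts (Φ (C s, z)) = 0
    · rw [hχ, zero_mul, abs_zero]; exact hB0
    · have h := hRb s (hsupp s hs hχ)
      rw [abs_mul, abs_of_nonneg (mwCut_mem_Icc F γ b₀ p₀ j Ts _).1, abs_of_pos h.1]
      calc mwCut F γ b₀ p₀ j Ts (Φ (C s, z)) * (Real.rpow (ρ Ts (Φ (C s, z))) t * Real.rpow (ρ' Ts (Φ (C s, z))) (1 - t))
          ≤ 1 * Real.exp (ML + ML') := mul_le_mul (mwCut_mem_Icc F γ b₀ p₀ j Ts _).2 h.2 h.1.le zero_le_one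
        _ = Real.exp (ML + ML') := one_mul _
  -- × the Jacobian
  have hCJ0 : 0 ≤ CJ := (NNReal.coe_nonneg _).trans (hJle (C 0) z)
  have hJb : ∀ s ∈ I, |(J (C s, z) : ℝ)| ≤ CJ := fun s _ => by rw [abs_of_nonneg (NNReal.coe_nonneg _)]; exact hJle _ _
  have key := lipschitzOnWith_mul_of_bound hAR hARb hLJ hJb hB0 hCJ0
  -- `wNum` unfolds to the triple product
  refine (lipschitzOnWith_iff_dist_le_mul.2 fun x hx y hy => ?_)
  have h := lipschitzOnWith_iff_dist_le_mul.1 key x hx y hy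
  simpa only [wNum] using h

end Weight

/-! ## §4 (W-Lip) — paths AND squares, the letter shapes of ✓`…OrganTangentILawRegOfWeightLip` — from the chart-primitive path letters -/

section WLip

/-- ★★★ **(W-Lip) FROM THE CHART-PRIMITIVE PATH LETTERS** — ONE real `bW` (depending on the frame's constants and the three moduli `D, Kρ, Kρ′, KJ` only — NOT on `t ∈ [0,1]`, the
path, the square or the fibre point) such that BOTH (W-Lip) clauses of ✓`ilawRegX∕V3∕Sq_of_weightLip` hold (texts verbatim: a.e.-`z` `LipschitzOnWith (Real.nnabs bW)` of
`s ↦ wNum_t (X s) z` on `Set.Ioo (-1) 2` along near relational paths, and of `s ↦ wNum_t (X s s′) z` for `s′ ∈ Icc 0 1` along near relational squares), FROM: the frame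
(positivity + continuity of `ρ_Ts, ρ′_Ts` on the `θ_Ts`-window, `hχsupp`, `J ≤ CJ`, `θ_n > 0`) and three DISPLAYED chart-primitive letters read along near relational paths and
square edges, pointwise in `z` — (Φ-disp-Lip) ONE modulus `D` for `s ↦ dist1 (plaqHol (descendTo n Ts (Φ (X s, z))) p)` at every level `j < n ≤ Ts`; (logρ-Lip)(logρ′-Lip) moduli
`Kρ, Kρ′` for `log ρ_Ts ∘ Φ (X ·, z)`, `log ρ′_Ts ∘ Φ (X ·, z)` on the sub-window set `{s ∈ Ioo (-1) 2 | PlaqSmall (24∕25·θ_Ts) (Φ (X s, z))}`; (J-Lip) a modulus `KJ` for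
`s ↦ J (X s, z)`.  These are the D0 «MINIMISER CHART» typer's hand-over ([Balaban1985Variational] Thm 1 (10) p.279 ∕ Prop 9 (190) p.309 for the chart's response, SOURCES
only). [folklore] -/
theorem weightLip_of_chartLetters (F : T3Family) (γ b₀ p₀ : ℝ) (j Ts : ℕ) (hjTs : j + 1 ≤ Ts)
    (ρ ρ' : (i : ℕ) → GaugeField (F.P i) 0 ↥(Matrix.specialUnitaryGroup (Fin 2) ℂ) → ℝ)
    (hρc : ContinuousOn (ρ Ts) {U | PlaqSmall (θBal F.L γ b₀ p₀ Ts) U}) (hρ'c : ContinuousOn (ρ' Ts) {U | PlaqSmall (θBal F.L γ b₀ p₀ Ts) U})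
    (hρpos : ∀ U, PlaqSmall (θBal F.L γ b₀ p₀ Ts) U → 0 < ρ Ts U ∧ 0 < ρ' Ts U) (hθ : ∀ n, 0 < θBal F.L γ b₀ p₀ n)
    (hχsupp : ∀ U, mwCut F γ b₀ p₀ j Ts U ≠ 0 → ∀ (n : ℕ) (hjn : j + 1 ≤ n) (hnK : n ≤ Ts), PlaqSmall (24 / 25 * θBal F.L γ b₀ p₀ n) (descendTo F ℰp n Ts hnK U))
    {Z : Type} [MeasurableSpace Z] (τ : Measure Z)
    (Φ : GaugeField (F.P j) 0 ↥(Matrix.specialUnitaryGroup (Fin 2) ℂ) × Z → GaugeField (F.P Ts) 0 ↥(Matrix.specialUnitaryGroup (Fin 2) ℂ))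
    (J : GaugeField (F.P j) 0 ↥(Matrix.specialUnitaryGroup (Fin 2) ℂ) × Z → ℝ≥0) (CJ : ℝ) (hJle : ∀ V z, (J (V, z) : ℝ) ≤ CJ)
    (rc : ℝ) (D Kρ Kρ' KJ : ℝ≥0)
    -- the three chart-primitive letters along near relational PATHS
    (hPdisp : ∀ (B' : PBond (F.P j) 0) (m' : Fin 3 → ℝ) (U₂ : GaugeField (F.P j) 0 ↥(Matrix.specialUnitaryGroup (Fin 2) ℂ))
      (X : ℝ → GaugeField (F.P j) 0 ↥(Matrix.specialUnitaryGroup (Fin 2) ℂ)), ‖m'‖ ≤ rc * (θBal F.L γ b₀ p₀ j / 4) → PlaqSmall (θBal F.L γ b₀ p₀ j / 4) U₂ →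
      (∀ s e, e ≠ B' → X s e = U₂ e) → (∀ s, X s B' = U₂ B' * expPt (s • m')) → ∀ (z : Z) (n : ℕ) (hjn : j + 1 ≤ n) (hnT : n ≤ Ts) (p : Plaq (F.P n) 0),
        LipschitzOnWith D (fun s => dist1 (GaugeField.plaqHol (descendTo F ℰp n Ts hnT (Φ (X s, z))) p)) (Set.Ioo (-1) 2))
    (hPρ : ∀ (B' : PBond (F.P j) 0) (m' : Fin 3 → ℝ) (U₂ : GaugeField (F.P j) 0 ↥(Matrix.specialUnitaryGroup (Fin 2) ℂ))
      (X : ℝ → GaugeField (F.P j) 0 ↥(Matrix.specialUnitaryGroup (Fin 2) ℂ)), ‖m'‖ ≤ rc * (θBal F.L γ b₀ p₀ j / 4) → PlaqSmall (θBal F.L γ b₀ p₀ j / 4) U₂ →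
      (∀ s e, e ≠ B' → X s e = U₂ e) → (∀ s, X s B' = U₂ B' * expPt (s • m')) → ∀ z : Z,
        LipschitzOnWith Kρ (fun s => Real.log (ρ Ts (Φ (X s, z)))) {s | s ∈ Set.Ioo (-1 : ℝ) 2 ∧ PlaqSmall (24 / 25 * θBal F.L γ b₀ p₀ Ts) (Φ (X s, z))} ∧
        LipschitzOnWith Kρ' (fun s => Real.log (ρ' Ts (Φ (X s, z)))) {s | s ∈ Set.Ioo (-1 : ℝ) 2 ∧ PlaqSmall (24 / 25 * θBal F.L γ b₀ p₀ Ts) (Φ (X s, z))})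
    (hPJ : ∀ (B' : PBond (F.P j) 0) (m' : Fin 3 → ℝ) (U₂ : GaugeField (F.P j) 0 ↥(Matrix.specialUnitaryGroup (Fin 2) ℂ))
      (X : ℝ → GaugeField (F.P j) 0 ↥(Matrix.specialUnitaryGroup (Fin 2) ℂ)), ‖m'‖ ≤ rc * (θBal F.L γ b₀ p₀ j / 4) → PlaqSmall (θBal F.L γ b₀ p₀ j / 4) U₂ →
      (∀ s e, e ≠ B' → X s e = U₂ e) → (∀ s, X s B' = U₂ B' * expPt (s • m')) → ∀ z : Z,
        LipschitzOnWith KJ (fun s => (J (X s, z) : ℝ)) (Set.Ioo (-1) 2))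
    -- the same three letters along the `s`-edges of near relational SQUARES
    (hSdisp : ∀ (B B' : PBond (F.P j) 0) (m m' : Fin 3 → ℝ) (V00 : GaugeField (F.P j) 0 ↥(Matrix.specialUnitaryGroup (Fin 2) ℂ))
      (Y : ℝ → GaugeField (F.P j) 0 ↥(Matrix.specialUnitaryGroup (Fin 2) ℂ)) (X : ℝ → ℝ → GaugeField (F.P j) 0 ↥(Matrix.specialUnitaryGroup (Fin 2) ℂ)),
      ‖m‖ ≤ rc * (θBal F.L γ b₀ p₀ j / 4) → ‖m'‖ ≤ rc * (θBal F.L γ b₀ p₀ j / 4) → PlaqSmall (θBal F.L γ b₀ p₀ j / 4) V00 →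
      (∀ s e, e ≠ B → Y s e = V00 e) → (∀ s, Y s B = V00 B * expPt (s • m)) → (∀ s s' e, e ≠ B' → X s s' e = Y s e) → (∀ s s', X s s' B' = Y s B' * expPt (s' • m')) →
      ∀ s' ∈ Set.Icc (0:ℝ) 1, ∀ (z : Z) (n : ℕ) (hjn : j + 1 ≤ n) (hnT : n ≤ Ts) (p : Plaq (F.P n) 0),
        LipschitzOnWith D (fun s => dist1 (GaugeField.plaqHol (descendTo F ℰp n Ts hnT (Φ (X s s', z))) p)) (Set.Ioo (-1) 2))
    (hSρ : ∀ (B B' : PBond (F.P j) 0) (m m' : Fin 3 → ℝ) (V00 : GaugeField (F.P j) 0 ↥(Matrix.specialUnitaryGroup (Fin 2) ℂ))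
      (Y : ℝ → GaugeField (F.P j) 0 ↥(Matrix.specialUnitaryGroup (Fin 2) ℂ)) (X : ℝ → ℝ → GaugeField (F.P j) 0 ↥(Matrix.specialUnitaryGroup (Fin 2) ℂ)),
      ‖m‖ ≤ rc * (θBal F.L γ b₀ p₀ j / 4) → ‖m'‖ ≤ rc * (θBal F.L γ b₀ p₀ j / 4) → PlaqSmall (θBal F.L γ b₀ p₀ j / 4) V00 →
      (∀ s e, e ≠ B → Y s e = V00 e) → (∀ s, Y s B = V00 B * expPt (s • m)) → (∀ s s' e, e ≠ B' → X s s' e = Y s e) → (∀ s s', X s s' B' = Y s B' * expPt (s' • m')) →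
      ∀ s' ∈ Set.Icc (0:ℝ) 1, ∀ z : Z,
        LipschitzOnWith Kρ (fun s => Real.log (ρ Ts (Φ (X s s', z)))) {s | s ∈ Set.Ioo (-1 : ℝ) 2 ∧ PlaqSmall (24 / 25 * θBal F.L γ b₀ p₀ Ts) (Φ (X s s', z))} ∧
        LipschitzOnWith Kρ' (fun s => Real.log (ρ' Ts (Φ (X s s', z)))) {s | s ∈ Set.Ioo (-1 : ℝ) 2 ∧ PlaqSmall (24 / 25 * θBal F.L γ b₀ p₀ Ts) (Φ (X s s', z))})
    (hSJ : ∀ (B B' : PBond (F.P j) 0) (m m' : Fin 3 → ℝ) (V00 : GaugeField (F.P j) 0 ↥(Matrix.specialUnitaryGroup (Fin 2) ℂ))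
      (Y : ℝ → GaugeField (F.P j) 0 ↥(Matrix.specialUnitaryGroup (Fin 2) ℂ)) (X : ℝ → ℝ → GaugeField (F.P j) 0 ↥(Matrix.specialUnitaryGroup (Fin 2) ℂ)),
      ‖m‖ ≤ rc * (θBal F.L γ b₀ p₀ j / 4) → ‖m'‖ ≤ rc * (θBal F.L γ b₀ p₀ j / 4) → PlaqSmall (θBal F.L γ b₀ p₀ j / 4) V00 →
      (∀ s e, e ≠ B → Y s e = V00 e) → (∀ s, Y s B = V00 B * expPt (s • m)) → (∀ s s' e, e ≠ B' → X s s' e = Y s e) → (∀ s s', X s s' B' = Y s B' * expPt (s' • m')) →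
      ∀ s' ∈ Set.Icc (0:ℝ) 1, ∀ z : Z, LipschitzOnWith KJ (fun s => (J (X s s', z) : ℝ)) (Set.Ioo (-1) 2)) :
    ∃ bW : ℝ, ∀ t : ℝ, 0 ≤ t → t ≤ 1 →
      (∀ (B' : PBond (F.P j) 0) (m' : Fin 3 → ℝ) (U₂ : GaugeField (F.P j) 0 ↥(Matrix.specialUnitaryGroup (Fin 2) ℂ))
        (X : ℝ → GaugeField (F.P j) 0 ↥(Matrix.specialUnitaryGroup (Fin 2) ℂ)), ‖m'‖ ≤ rc * (θBal F.L γ b₀ p₀ j / 4) → PlaqSmall (θBal F.L γ b₀ p₀ j / 4) U₂ →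
        (∀ s e, e ≠ B' → X s e = U₂ e) → (∀ s, X s B' = U₂ B' * expPt (s • m')) →
        ∀ᵐ z ∂τ, LipschitzOnWith (Real.nnabs bW) (fun s => wNum F γ b₀ p₀ j Ts ρ ρ' Φ J t (X s) z) (Set.Ioo (-1) 2)) ∧
      (∀ (B B' : PBond (F.P j) 0) (m m' : Fin 3 → ℝ) (V00 : GaugeField (F.P j) 0 ↥(Matrix.specialUnitaryGroup (Fin 2) ℂ))
        (Y : ℝ → GaugeField (F.P j) 0 ↥(Matrix.specialUnitaryGroup (Fin 2) ℂ)) (X : ℝ → ℝ → GaugeField (F.P j) 0 ↥(Matrix.specialUnitaryGroup (Fin 2) ℂ)),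
        ‖m‖ ≤ rc * (θBal F.L γ b₀ p₀ j / 4) → ‖m'‖ ≤ rc * (θBal F.L γ b₀ p₀ j / 4) → PlaqSmall (θBal F.L γ b₀ p₀ j / 4) V00 →
        (∀ s e, e ≠ B → Y s e = V00 e) → (∀ s, Y s B = V00 B * expPt (s • m)) → (∀ s s' e, e ≠ B' → X s s' e = Y s e) → (∀ s s', X s s' B' = Y s B' * expPt (s' • m')) →
        ∀ s' ∈ Set.Icc (0:ℝ) 1, ∀ᵐ z ∂τ, LipschitzOnWith (Real.nnabs bW) (fun s => wNum F γ b₀ p₀ j Ts ρ ρ' Φ J t (X s s') z) (Set.Ioo (-1) 2)) := by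
  obtain ⟨ML, hML⟩ := exists_abs_log_le_of_plaq_le F γ b₀ p₀ Ts (ρ Ts) hρc (fun U hU => (hρpos U hU).1) (hθ Ts)
  obtain ⟨ML', hML'⟩ := exists_abs_log_le_of_plaq_le F γ b₀ p₀ Ts (ρ' Ts) hρ'c (fun U hU => (hρpos U hU).2) (hθ Ts)
  set K : ℝ≥0 := ((∑ i ∈ Finset.range (Ts - j), ∑ _p : Plaq (F.P (j + 1 + i)) 0, Real.toNNReal (1 / ((24 / 25 - 1 / 2) * θBal F.L γ b₀ p₀ (j + 1 + i))) * D)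
        * Real.toNNReal (Real.exp (ML + ML')) + Real.toNNReal 1 * (Real.toNNReal (Real.exp (ML + ML')) * (Kρ + Kρ'))) * Real.toNNReal CJ
        + Real.toNNReal (Real.exp (ML + ML')) * KJ with hKdef
  have hKabs : Real.nnabs (K : ℝ) = K := by ext; rw [Real.coe_nnabs, abs_of_nonneg (NNReal.coe_nonneg K)]
  refine ⟨(K : ℝ), fun t ht0 ht1 => ⟨?_, ?_⟩⟩
  · intro B' m' U₂ X hm' hU₂ hoff hon
    refine ae_of_all τ fun z => ?_
    rw [hKabs]
    obtain ⟨hLρ, hLρ'⟩ := hPρ B' m' U₂ X hm' hU₂ hoff hon z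
    exact lipschitzOnWith_wNum_of_chartLetters F γ b₀ p₀ j Ts hjTs ρ ρ' hρpos hθ ML ML' hML hML' hχsupp Φ J CJ hJle t ht0 ht1 D Kρ Kρ' KJ X z
      (Set.Ioo (-1) 2) (hPdisp B' m' U₂ X hm' hU₂ hoff hon z) hLρ hLρ' (hPJ B' m' U₂ X hm' hU₂ hoff hon z)
  · intro B B' m m' V00 Y X hm hm' hV hYoff hYon hXoff hXon s' hs'
    refine ae_of_all τ fun z => ?_
    rw [hKabs]
    obtain ⟨hLρ, hLρ'⟩ := hSρ B B' m m' V00 Y X hm hm' hV hYoff hYon hXoff hXon s' hs' z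
    exact lipschitzOnWith_wNum_of_chartLetters F γ b₀ p₀ j Ts hjTs ρ ρ' hρpos hθ ML ML' hML hML' hχsupp Φ J CJ hJle t ht0 ht1 D Kρ Kρ' KJ (fun s => X s s') z
      (Set.Ioo (-1) 2) (hSdisp B B' m m' V00 Y X hm hm' hV hYoff hYon hXoff hXon s' hs' z) hLρ hLρ' (hSJ B B' m m' V00 Y X hm hm' hV hYoff hYon hXoff hXon s' hs' z)

end WLip

end Summit.QuantumFields.YangMills.Theorems.OrganTangentWeightLipOfChartLetters

end
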